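import Summits.HubbardSuperconductivity.HubbardSuperconductivity.Theorems.SoloBlindCooperBracket
import Summits.HubbardSuperconductivity.HubbardSuperconductivity.Theorems.SoloBlindReciprocalBlocks
import HarnessLib

/-!
# The trial state from reciprocal block data (solo-blind programme, Theorem 28(e))

The operator-free reduction of the `U = 0` book-end (claim C53): given, at one side `L ≥ 3`,

* a Fermi set `F` with a separating level `μ` and a set of modes `A ⊇ F` with `#(A∖F) = #F = M+2`,
* a colouring `col` of the modes with equal fibre sizes on `A∖F` and on `F`, block weights
  `a_c > 0`, the weights `x = a∘col` on `A∖F` and `x = (a∘col)⁻¹` on `F` (`x ≥ 0` everywhere),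
* the variance condition `Σ_{k∈A} x_k/(1+x_k)² > 12`, and gain amplitudes `g_k ≥ 0` with
  `g_k²(1+x_k)(2+x_k) ≤ x_k` on `A`,

there is a nonzero vector `Ψ` of the sector `(2(M+2), S^z = 0)` (the weighted number-projected
condensate with signs following the `d`-wave profile) with

  `re⟨Ψ, (H₀ + (-t)ΔᴴΔ)Ψ⟩ ≤ (2Σ_Fε + 2Σ_{A∖F}(ε-μ)·2x/(1+2x) + 2Σ_F(μ-ε)·2/(2+x) - t(Σ_A|w|g)²)‖Ψ‖²`

for every `t ≥ 0` (`trial_of_blocks`). Combined with `crutch_hasLongRangeOrder_of_trials`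
(`SoloBlindVariationalCrutch`), claim C53 is thereby reduced to exhibiting such block data on the
dyadic Fermi-surface windows of `SoloBlindFermiSurfaceWindows` with
`cost - (g/L²)(Σ|w|g)² ≤ -κ(g)L²` for all large even `L` — finite combinatorics and the
Cooper-logarithm arithmetic, no Fock-space reasoning (report §5.20 (6), items E5c/E6b(ii)).
[this work]
-/

noncomputable section

namespace Summit.HubbardSuperconductivity.HubbardSuperconductivity.Theorems.EnergyBalance

open Matrix Finset Literature.Probability.LatticeModels
  Literature.MathematicalPhysics.QuantumLattice
  Summit.HubbardSuperconductivity.HubbardSuperconductivity.Theorems.PairCondensate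
  Summit.HubbardSuperconductivity.HubbardSuperconductivity.Theorems.WeightedCondensate
  Summit.HubbardSuperconductivity.HubbardSuperconductivity.Theorems.CanonicalOccupation
open scoped ComplexOrder ComplexConjugate

variable {L : ℕ} [NeZero L]

/-- `esy[x, s, j]` = the `j`-th elementary symmetric sum of the weights `x` over `s`. -/
local notation "esy[" x ", " s ", " j "]" =>
  (∑ t ∈ Finset.powersetCard j s, ∏ k ∈ t, x k)

local notation "Φ[" S "]" =>
  (List.prod (List.map (fun k : TorusSite 2 _ => (pairMode k)ᴴ) (Finset.toList S)) *ᵥ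
    (vacuum : Fock (Orb (FermionTorus 2 _))))

/-- The `d`-wave profile `w_k = pairFieldMode dWaveFormFactor L k`. -/
local notation "W[" k "]" => (pairFieldMode dWaveFormFactor _ k)

/-- The weighted number-projected condensate. -/
local notation "Ψ[" φ ", " A " ; " i "]" =>
  (∑ S ∈ Finset.powersetCard i A, ((((∏ k ∈ S, φ k : ℝ))) : ℂ) • Φ[S])

/-- **Theorem 28(e) (the trial state from reciprocal block data).** [this work] -/
theorem trial_of_blocks (hL : 3 ≤ L) (F A : Finset (TorusSite 2 L)) (hFA : F ⊆ A) (M : ℕ)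
    (hF : #F = M + 2) (hAF : #(A \ F) = M + 2) (μ : ℝ) (hsep : ∀ k ∈ F, torusBand L k ≤ μ)
    (hsep' : ∀ k ∈ A \ F, μ ≤ torusBand L k) {ι : Type*} [DecidableEq ι]
    (col : TorusSite 2 L → ι)
    (hcard : ∀ c, #((A \ F).filter fun k => col k = c) = #(F.filter fun k => col k = c))
    (a : ι → ℝ) (ha : ∀ c, 0 < a c) (x : TorusSite 2 L → ℝ) (hx0 : ∀ k, 0 ≤ x k)
    (hxP : ∀ k ∈ A \ F, x k = a (col k)) (hxQ : ∀ k ∈ F, x k = (a (col k))⁻¹)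
    (hV : 12 < ∑ k ∈ A, x k / (1 + x k) ^ 2) (g : TorusSite 2 L → ℝ) (hg0 : ∀ k ∈ A, 0 ≤ g k)
    (hg : ∀ k ∈ A, g k ^ 2 * ((1 + x k) * (2 + x k)) ≤ x k) {t : ℝ} (ht : 0 ≤ t) :
    ∃ Ψ : Fock (Orb (FermionTorus 2 L)),
      Ψ ∈ szSector (Λ := FermionTorus 2 L) (2 * (M + 2)) 0 ∧ Ψ ≠ 0 ∧
        (star Ψ ⬝ᵥ (hubbardTorus 2 L 1 0 + ((-t : ℝ) : ℂ) •
            ((pairField dWaveFormFactor L)ᴴ * pairField dWaveFormFactor L)) *ᵥ Ψ).re ≤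
          (2 * ∑ k ∈ F, torusBand L k +
              (2 * ∑ k ∈ A \ F, (torusBand L k - μ) * (2 * x k / (1 + 2 * x k)) +
                2 * ∑ k ∈ F, (μ - torusBand L k) * (2 / (2 + x k))) -
              t * (∑ k ∈ A, |W[k]| * g k) ^ 2) * (star Ψ ⬝ᵥ Ψ).re := by
  -- the amplitudes: `φ_k = sign(w_k)√x_k`
  obtain ⟨φ, hφ⟩ : ∃ φ : TorusSite 2 L → ℝ,
      ∀ k, φ k = (if 0 ≤ W[k] then 1 else -1) * Real.sqrt (x k) := ⟨_, fun _ => rfl⟩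
  have hφ2 : ∀ k, φ k ^ 2 = x k := fun k => by
    rw [hφ, mul_pow, Real.sq_sqrt (hx0 k)]
    split_ifs <;> norm_num
  have hφW : ∀ k ∈ A, 0 ≤ W[k] * φ k := fun k _ => by
    rw [hφ]
    split_ifs with h
    · rw [one_mul]; exact mul_nonneg h (Real.sqrt_nonneg _)
    · have h' : W[k] * (-1 * Real.sqrt (x k)) = (-W[k]) * Real.sqrt (x k) := by ring
      rw [h']
      exact mul_nonneg (by linarith [lt_of_not_ge h]) (Real.sqrt_nonneg _)
  have hesy : ∀ j, esy[fun k => φ k ^ 2, A, j] = esy[x, A, j] := fun j =>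
    sum_congr rfl fun t _ => prod_congr rfl fun k _ => hφ2 k
  -- the fugacity window from the reciprocal blocks `P = A \ F`, `Q = F`
  have hU : A \ F ∪ F = A := sdiff_union_of_subset hFA
  have hP : #(A \ F) = M + 1 + 1 := by rw [hAF]
  have hQ : #F = M + 1 + 1 := by rw [hF]
  have hV' : 12 < ∑ k ∈ A \ F ∪ F, x k / (1 + x k) ^ 2 := by rwa [hU]
  obtain ⟨hC1, hC2, hW1, hW2, hmono⟩ :=
    blocks_fugacity_window (A \ F) F sdiff_disjoint col hcard a ha x hxP hxQ hP hQ hV'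
  rw [hU] at hC1 hC2 hW1 hW2 hmono
  have e3 : M + 1 + 2 = M + 3 := rfl
  rw [e3] at hW2
  -- the bracket for `Ψ^φ_{A,M+2}`
  have hb := trial_bracket hL φ g A F hFA M hF μ hsep hsep' ((hesy _).symm ▸ hC1)
    ((hesy _).symm ▸ hC2) (by rw [hesy, hesy]; exact hW1) (by rw [hesy, hesy]; exact hW2)
    (by rw [hesy, hesy]; exact hmono) hφW hg0 (fun k hk => by rw [hφ2]; exact hg k hk) ht
  refine ⟨Ψ[φ, A ; M + 2], wcond_mem_szSector φ A (M + 2), wcond_ne_zero φ A ?_, ?_⟩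
  · rw [hesy]; exact hC2.ne'
  · simp only [hφ2] at hb
    exact hb

end Summit.HubbardSuperconductivity.HubbardSuperconductivity.Theorems.EnergyBalance
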